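import Mathlib
import Summits.Ventures.PercRepro2.CoinTreeCore
import Summits.Ventures.PercRepro2.CoinTreeAncestor
import Summits.Ventures.PercRepro2.CoinOrTailKDefs
import Summits.Ventures.PercRepro2.CoinOrTailKSums
import Summits.Ventures.PercRepro2.CoinOrTailKAlg
import Summits.Ventures.PercRepro2.CoinOrTailKCore
import Summits.Ventures.PercRepro2.CoinMixBlock
import Summits.Ventures.PercRepro2.CoinOrTailKOneAlg
import Summits.Ventures.PercRepro2.CoinOrTailKChainAlg
import Summits.Ventures.PercRepro2.CoinOrTailKChainFunctional
import Summits.Ventures.PercRepro2.CoinOrTailKChainCore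

/-!
# The three-route core `s → {p, q, r} → a` with the markers `p, q` — an instantiation check
(blind cell PercRepro2, night-2 g11; NIGHT2-DARC.md §43)

A concrete coin system on `Fin 7` (s = 0, p = 1, q = 2, r = 3, a = 4, w = 5, t = 6):
`s → p → a`, `s → q → a`, `s → r → a` — three entries of the tail, the third one `r` on a route
that passes through NO marker — and the head coins `a → t`, `w → t`, `p → w`, `r → t`; ten coins,
all random.  The core `U = {p, q, r}` is an out-tree (`TreeCore`, by `decide`), `OrTailK` holds by
`decide`, and `darc_of_orTailTreeKOne` gives row 2′DARC at `a → w` for the markers `p, q` and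
every probability vector.  This is the first kernel instance with an UNDOMINATED entry (the
open case of §40.4 / §41.4–41.9: clean on `10⁷` instances, no certificate per coin monomial).
-/

namespace Summit.Ventures.PercRepro2.Coin

namespace OrTailKOneExample

open Classical

/-- The ten coins of the example. -/
def arcsEx : Fin 10 → Finset (Fin 7 × Fin 7)
  | 0 => {(0, 1)}   -- s → p
  | 1 => {(0, 2)}   -- s → q
  | 2 => {(0, 3)}   -- s → r
  | 3 => {(1, 4)}   -- p → a
  | 4 => {(2, 4)}   -- q → a
  | 5 => {(3, 4)}   -- r → a
  | 6 => {(4, 6)}   -- a → t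
  | 7 => {(5, 6)}   -- w → t
  | 8 => {(1, 5)}   -- p → w
  | 9 => {(3, 6)}   -- r → t

/-- The entry coins: `c p = 3`, `c q = 4`, `c r = 5`. -/
def cEx : Fin 7 → Fin 10
  | 1 => 3
  | 2 => 4
  | 3 => 5
  | _ => 0

/-- The tree coins. -/
def tcEx : Fin 7 → Fin 10
  | 1 => 0
  | 2 => 1
  | 3 => 2
  | _ => 0

/-- The parent map. -/
def parEx : Fin 7 → Fin 7
  | _ => 0

/-- The rank. -/
def rkEx : Fin 7 → ℕ
  | 1 => 1
  | 2 => 1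
  | 3 => 1
  | _ => 0

/-- Every coin is a single arc, so `SameEnds` holds. -/
lemma sameEnds_ex : SameEnds arcsEx := by
  intro e xy hxy x'y' hx'y'
  fin_cases e <;> simp [arcsEx] at hxy hx'y' <;> subst hxy <;> subst hx'y' <;>
    exact ⟨Or.inl rfl, Or.inr rfl⟩

/-- `{p, q, r}` is an out-tree core of `s`. -/
lemma treeCore_ex : TreeCore arcsEx 0 {1, 2, 3} tcEx parEx rkEx where
  tree := by decide
  par_mem := by decide
  rank := by decide
  into_C := by decide
  into_s := by decide
  s_notin := by decide

/-- The core with the tail `a = 4` entered from `p, q, r` is a three-entry OR-tail. -/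
lemma orTailK_ex : OrTailK arcsEx 0 {1, 2, 3} {1, 2, 3} cEx 4 where
  ent_sub := by decide
  s_notin := by decide
  a_notin := by decide
  a_ne_s := by decide
  into_U := by decide
  into_s := by decide
  into_a := by decide
  arcs_c := by decide
  c_inj := by decide

/-- **Row 2′DARC at the arc `a → w` for the markers `p, q` on the three-route core with the
undominated entry `r`, for every probability vector** — no hypothesis beyond `IsProbVec`. -/
theorem darc_orTailKOne_example {R : Type*} [Field R] [LinearOrder R] [IsStrictOrderedRing R]
    (pr : Fin 10 → R) (hp : IsProbVec pr) :
    DARC pr arcsEx 0 {6} 1 2 4 5 :=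
  darc_of_orTailTreeKOne pr hp sameEnds_ex orTailK_ex treeCore_ex (by decide) (by decide)
    (r₀ := 3) (by decide)
    (by
      intro r hr hr3
      fin_cases hr
      · exact Or.inl ⟨0, by decide, by decide⟩
      · exact Or.inr ⟨0, by decide, by decide⟩
      · exact absurd rfl hr3)
    (by decide) (by decide) (by decide) (by decide)

end OrTailKOneExample

end Summit.Ventures.PercRepro2.Coin
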